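import Mathlib
import Summits.ResolutionOfSingularities.ResolutionOfSingularities.Theorems.WeightedInvariantLocalWeightedDropWildMonicMaxFlagLimit
import Summits.ResolutionOfSingularities.ResolutionOfSingularities.Theorems.WeightedInvariantLocalWeightedDropWildMonicSCleanShift
import Summits.ResolutionOfSingularities.ResolutionOfSingularities.Theorems.WeightedInvariantLocalWeightedDropWildMonicWCleanProcess

/-!
# `WeightedInvariant.LocalWeightedDrop`, line `hasse-ridge-face-selection`, S3ρ sub-stub S3ρD `stub_wildMonicSurfaceDescent`: item D-0
# «maximising flag» — `s`-ATTAINMENT OVER RE-CENTRINGS (D-0d, case (α): the plane flag is fixed), REDUCED TO THE COMPLETENESS OF THE CLASS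

Crux item stmt-ResolutionOfSingularities-8899 `LocalWeightedDrop` (route `ResolutionOfSingularities/WeightedInvariant`), engine of the door
`HypersurfaceCentreConstruction` stmt-ResolutionOfSingularities-19897.  [OURS · L1 W4.3, chain w43, res-L1-w43-stub-3 (gen 3) on roadmap item
D-0 of `L/res-L1-w43-stub-7/S3RHOD-ROADMAP.md` (owners res-type-083 / stub-7); spec `L/res-L1-w43-stub-3/D0-SPEC.md` §8.  MODEL: Perlega,
arXiv:2011.14443 Ch. 5 §2 (Lemma 5.2.2 `s_under_coord_changes`) and §3 (Prop. 5.3.5 `maximum_over_y_and_z_exists`), restricted to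
re-centrings `y ↦ y + g` with the plane flag fixed (the sub-case `h = 0` forced by `IsN0` when the flag curve is exceptional).
This file INSTANTIATES res-D-pv-056 AS stub-5's abstract limit kernel `WildMonic.exists_isGreatest_of_complete'` (`…WildMonicMaxFlagLimit`)
on the class `G` of re-centrings of a base tuple `B` preserving a fixed setting `(δ₀, r₀)` (`dRes`, `excExp`), with res-D-pv-005 AS
stub-7's Perlega Lemma 5.2.2 (`natCast_le_sFlag_shift`, `sFlag_shift_lt`, `…WildMonicSCleanShift`) discharging the kernel's `hdrop` and
`husc` WITHOUT ANY CLEANNESS HYPOTHESIS (closeness at level `M` := the difference lies on or above every `M'`-line, `M' ≤ M`, and the later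
member is in the class).  What is left as a hypothesis is exactly the completeness of the class (`hcomplete`: a chain of members, Cauchy
for the line conditions, has a limit IN THE CLASS on or above the lines — `…WildMonicFlagCauchy` gives the limit series; membership of
the limit is Perlega's «`(g_∞, h_∞) ∈ 𝒢` by Lemma (m_under_coord_changes)», to be typed), non-emptiness and finiteness of `s` on the class.
Definition-free.]

* `LineCond d δ₀ r₀ M g` is NOT a definition but the recurring proposition
  `M·δ₀ + w_M(r₀) ≤ d!·ord_{w_M}(g)`, `w_M = ![δ₀!, M]` («`g` lies on or above the `M`-line», stub-7's `hg`), spelled out each time;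
* `lineCond_add` — on-or-above is closed under sums (ultrametric);
* **`exists_isGreatest_sFlag_shift_of_complete`** — Per17 Prop. 5.3.5 for re-centrings: in the class `G` a member with finite, greatest
  `sFlag` exists, given completeness, non-emptiness and finiteness.
-/

set_option linter.dupNamespace false -- mandated namespace of this single-conjunct summit

namespace Summit.ResolutionOfSingularities.ResolutionOfSingularities.Theorems

namespace WildMonic

open MvPowerSeries

variable {k : Type} [Field k] {d : ℕ}

/-- On-or-above the `M`-line is closed under sums: `c ≤ d!·ord_w(g)` and `c ≤ d!·ord_w(g')` give `c ≤ d!·ord_w(g + g')`. -/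
theorem lineCond_add {w : Fin 2 → ℕ} {c : ℕ∞} {g g' : MvPowerSeries (Fin 2) k}
    (hg : c ≤ (d.factorial : ℕ∞) * g.weightedOrder w) (hg' : c ≤ (d.factorial : ℕ∞) * g'.weightedOrder w) :
    c ≤ (d.factorial : ℕ∞) * (g + g').weightedOrder w := by
  have hmin : min (g.weightedOrder w) (g'.weightedOrder w) ≤ (g + g').weightedOrder w := min_weightedOrder_le_add _
  rcases min_choice (g.weightedOrder w) (g'.weightedOrder w) with h | h <;> rw [h] at hmin
  · exact hg.trans (by gcongr)
  · exact hg'.trans (by gcongr)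

/-- **PER17 PROP. 5.3.5 FOR RE-CENTRINGS (plane flag fixed), modulo completeness of the class.**  Base tuple `B`, boundary `E`, a setting
`(δ₀, r₀)`, `0 < d`, and the class
`G = {g : g(0) = 0, dRes E N(shift d B g) = δ₀, excExp E N(shift d B g) = r₀}` of setting-preserving re-centrings.  If `G` is non-empty,
`sFlag` is finite on `G`, and `G` is COMPLETE for the line conditions (`hcomplete`: every chain `c` in `G` with `sFlag (c k) = N k` strictly
increasing and `c (k+1) − c k` on or above every `M'`-line, `M' ≤ N k`, has a limit `b ∈ G` with `b − c k` on or above every `M'`-line,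
`M' ≤ N k`), then some `g ∈ G` has the GREATEST `sFlag` on `G`.  Kernel: stub-5's `exists_isGreatest_of_complete'`; `hdrop`/`husc`:
stub-7's Lemma 5.2.2 (3)/(1) (`sFlag_shift_lt` / `natCast_le_sFlag_shift`).
[cite: Perlega2020, Prop. 5.3.5 with Lemma 5.2.2 (arXiv:2011.14443 Ch. 5 §2 p0058–p0059, §3 p0066 L60 – p0067 L40)] -/
theorem exists_isGreatest_sFlag_shift_of_complete (hd : 0 < d) (E : Finset (Fin 2)) (B : Fin d → MvPowerSeries (Fin 2) k)
    (δ₀ : ℕ) (r₀ : Fin 2 →₀ ℕ)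
    (hne : ∃ g : MvPowerSeries (Fin 2) k, constantCoeff g = 0 ∧ dRes E (newtonSet (shift d B g)) = δ₀ ∧
      excExp E (newtonSet (shift d B g)) = r₀)
    (hfin : ∀ g : MvPowerSeries (Fin 2) k, constantCoeff g = 0 → dRes E (newtonSet (shift d B g)) = δ₀ →
      excExp E (newtonSet (shift d B g)) = r₀ → sFlag E (newtonSet (shift d B g)) ≠ ⊤)
    (hcomplete : ∀ (c : ℕ → MvPowerSeries (Fin 2) k) (N : ℕ → ℕ), StrictMono N →
      (∀ j, constantCoeff (c j) = 0 ∧ dRes E (newtonSet (shift d B (c j))) = δ₀ ∧ excExp E (newtonSet (shift d B (c j))) = r₀ ∧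
        sFlag E (newtonSet (shift d B (c j))) = N j) →
      (∀ j M', M' ≤ N j → ((M' * δ₀ + Finsupp.weight ![δ₀.factorial, M'] r₀ : ℕ) : ℕ∞) ≤
        (d.factorial : ℕ∞) * (c (j + 1) - c j).weightedOrder ![δ₀.factorial, M']) →
      ∃ b : MvPowerSeries (Fin 2) k, constantCoeff b = 0 ∧ dRes E (newtonSet (shift d B b)) = δ₀ ∧
        excExp E (newtonSet (shift d B b)) = r₀ ∧
        ∀ j M', M' ≤ N j → ((M' * δ₀ + Finsupp.weight ![δ₀.factorial, M'] r₀ : ℕ) : ℕ∞) ≤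
          (d.factorial : ℕ∞) * (b - c j).weightedOrder ![δ₀.factorial, M']) :
    ∃ g : MvPowerSeries (Fin 2) k, constantCoeff g = 0 ∧ dRes E (newtonSet (shift d B g)) = δ₀ ∧
      excExp E (newtonSet (shift d B g)) = r₀ ∧ sFlag E (newtonSet (shift d B g)) ≠ ⊤ ∧
      ∀ g' : MvPowerSeries (Fin 2) k, constantCoeff g' = 0 → dRes E (newtonSet (shift d B g')) = δ₀ →
        excExp E (newtonSet (shift d B g')) = r₀ → sFlag E (newtonSet (shift d B g')) ≤ sFlag E (newtonSet (shift d B g)) := by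
  -- the class, the value, the closeness
  let G : MvPowerSeries (Fin 2) k → Prop := fun g =>
    constantCoeff g = 0 ∧ dRes E (newtonSet (shift d B g)) = δ₀ ∧ excExp E (newtonSet (shift d B g)) = r₀
  let s : MvPowerSeries (Fin 2) k → ℕ∞ := fun g => sFlag E (newtonSet (shift d B g))
  let Close : ℕ → MvPowerSeries (Fin 2) k → MvPowerSeries (Fin 2) k → Prop := fun M a b =>
    G b ∧ ∀ M', M' ≤ M → ((M' * δ₀ + Finsupp.weight ![δ₀.factorial, M'] r₀ : ℕ) : ℕ∞) ≤
      (d.factorial : ℕ∞) * (b - a).weightedOrder ![δ₀.factorial, M']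
  -- the setting of a member, re-based at another member
  have hshift : ∀ a b : MvPowerSeries (Fin 2) k, shift d (shift d B a) (b - a) = shift d B b := fun a b => by
    rw [shift_shift, sub_add_cancel]
  have hmono : ∀ {M M' : ℕ} {a b : MvPowerSeries (Fin 2) k}, M ≤ M' → Close M' a b → Close M a b :=
    fun hMM' h => ⟨h.1, fun M'' hM'' => h.2 M'' (hM''.trans hMM')⟩
  have htrans : ∀ {M : ℕ} {a b c : MvPowerSeries (Fin 2) k}, Close M a b → Close M b c → Close M a c := by
    intro M a b c hab hbc
    refine ⟨hbc.1, fun M' hM' => ?_⟩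
    have h1 : c - a = (c - b) + (b - a) := by ring
    rw [h1]
    exact lineCond_add (hbc.2 M' hM') (hab.2 M' hM')
  have hdrop : ∀ {a b : MvPowerSeries (Fin 2) k} {M : ℕ}, G a → G b → s a = M → (M : ℕ∞) ≤ s b → Close M a b := by
    intro a b M ha hb hsa hsb
    refine ⟨hb, fun M' hM' => ?_⟩
    by_contra hlt
    rw [not_le] at hlt
    have hs' : (M' : ℕ∞) ≤ sFlag E (newtonSet (shift d B a)) := by
      change (M' : ℕ∞) ≤ s a
      rw [hsa]; exact_mod_cast hM'
    have hδ : dRes E (newtonSet (shift d (shift d B a) (b - a))) = dRes E (newtonSet (shift d B a)) := by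
      rw [hshift, hb.2.1, ha.2.1]
    have hr : excExp E (newtonSet (shift d (shift d B a) (b - a))) = excExp E (newtonSet (shift d B a)) := by
      rw [hshift, hb.2.2, ha.2.2]
    have hlt' := sFlag_shift_lt E E (shift d B a) (b - a) hs' hδ hr hd (by rw [ha.2.1, ha.2.2]; exact hlt)
    rw [hshift] at hlt'
    have h2 : (M' : ℕ∞) ≤ s b := le_trans (by exact_mod_cast hM') hsb
    exact absurd (lt_of_le_of_lt h2 hlt') (lt_irrefl _)
  have husc : ∀ {a b : MvPowerSeries (Fin 2) k} {M : ℕ}, G a → s a = M → Close M a b → G b ∧ (M : ℕ∞) ≤ s b := by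
    intro a b M ha hsa hab
    refine ⟨hab.1, ?_⟩
    have hs' : (M : ℕ∞) ≤ sFlag E (newtonSet (shift d B a)) := by
      change (M : ℕ∞) ≤ s a
      rw [hsa]
    have hδ : dRes E (newtonSet (shift d (shift d B a) (b - a))) = dRes E (newtonSet (shift d B a)) := by
      rw [hshift, hab.1.2.1, ha.2.1]
    have hr : excExp E (newtonSet (shift d (shift d B a) (b - a))) = excExp E (newtonSet (shift d B a)) := by
      rw [hshift, hab.1.2.2, ha.2.2]
    have h1 := natCast_le_sFlag_shift E E (shift d B a) (b - a) hs' hδ hr (by rw [ha.2.1, ha.2.2]; exact hab.2 M le_rfl)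
    rw [hshift] at h1
    exact h1
  have hcomplete' : ∀ (c : ℕ → MvPowerSeries (Fin 2) k) (N : ℕ → ℕ), StrictMono N → (∀ j, G (c j) ∧ s (c j) = N j) →
      (∀ j j', j < j' → Close (N j) (c j) (c j')) → ∃ b, ∀ j, Close (N j) (c j) b := by
    intro c N hN hc hch
    obtain ⟨b, hb0, hbδ, hbr, hb⟩ := hcomplete c N hN (fun j => ⟨(hc j).1.1, (hc j).1.2.1, (hc j).1.2.2, (hc j).2⟩)
      (fun j M' hM' => (hch j (j + 1) (Nat.lt_succ_self j)).2 M' hM')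
    exact ⟨b, fun j => ⟨⟨hb0, hbδ, hbr⟩, fun M' hM' => hb j M' hM'⟩⟩
  obtain ⟨g, hg, hgs, hmax⟩ := exists_isGreatest_of_complete' s G Close hmono htrans hdrop husc hcomplete' hne
    (fun a ha => hfin a ha.1 ha.2.1 ha.2.2)
  exact ⟨g, hg.1, hg.2.1, hg.2.2, hgs, fun g' h0 hδ hr => hmax g' ⟨h0, hδ, hr⟩⟩

end WildMonic

end Summit.ResolutionOfSingularities.ResolutionOfSingularities.Theorems
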